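import Summits.CriticalPhenomena.Ising3DConformalLimit.Theses.FKParityRobustness
import Summits.CriticalPhenomena.Ising3DConformalLimit.Theorems.FKParityRobustnessIndependentStrandsJoinPinchToTetraDefs
import Summits.CriticalPhenomena.Ising3DConformalLimit.Theorems.FKParityRobustnessIndependentStrandsJoinLimitUpgrade
import Summits.CriticalPhenomena.Ising3DConformalLimit.Theorems.FKParityRobustnessIndependentStrandsJoinStubPerScale
import Summits.CriticalPhenomena.Ising3DConformalLimit.Theorems.GapForcesFarMerging.Negative.TransparentPassage
import Summits.CriticalPhenomena.Ising3DConformalLimit.Theorems.IsingEuclidUpgradeR4NonGaussianFatStep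
import HarnessLib

/-!
# `TetraMergingIO` ⟸ `EnergyGapPowerLaw ∧ PinchedTransparency ∧ OctaveTransfer` — the reduction of the line
# `pinch-to-tetra` (registered sub-goal `stub_pinchToTetraReduction`), and the five-piece composition of the crux
(crux item stmt-CriticalPhenomena-14625 `IndependentStrandsJoin`, route `FKParityRobustness`; line
`Cruxes/IndependentStrandsJoin/Lines/pinch_to_tetra.lean`, crux strategist p1 + lead
`prover-line-stmt-CriticalPhenomena-14625-c2-0`, 2026-08-17; `--supports stmt-CriticalPhenomena-14625`)

Theorem-only file over the line vocabulary `…PinchToTetraDefs` (`U4thin`, `Nthin`, `thinRatio`, `R4ratio`, `ThinMergingIO`,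
`OctaveTransfer`, `TetraMergingIO`, `LimitExists`) and the sibling crux `GapForcesFarMerging`'s landed engine
(`Theorems/GapForcesFarMerging/Negative/TransparentPassage.lean` and its imports: `SoftPackageNoBubble`,
`SinglePinchLawShape`, `SinglePinchPositiveShape`, `PinchedTransparencyShape`, `singlePinchLaw_of_gap_and_isoRP`,
`rpUnpinchIsoShape_criticalCorr`, `singlePinchPositiveShape_criticalCorr`, `softPackageNoBubble_criticalCorr`,
`avoidS_dyadic_le`, `exists_good_scale`, `NparS_pos`).  Results (axioms `propext`, `Classical.choice`, `Quot.sound`):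
* `thinMergingIO_of` — ENS2's dyadic scale iteration (`scaleIteration_soft_transparent`) RE-PROVED with its conclusion
  sharpened to the NAMED thin shape: over the soft package, single-pinch law + strict single-pinch positivity + pinched
  transparency ⟹ `ThinMergingIO S F` (the original contradiction hypothesis `¬FarMergingShape` is only ever used at
  the thin shape `Th(2^ℓ)` with constant `1/2`, so the same argument proves the sharper statement);
* `thinMergingIO_criticalCorr : EnergyGapPowerLaw → PinchedTransparencyShape cc2 (criticalCorr 3 4) →
  ThinMergingIO cc2 (criticalCorr 3 4)` (GAP enters once, through the landed isosceles RP minors);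
* `tetraMergingIO_of_thin : ThinMergingIO cc2 (criticalCorr 3 4) → OctaveTransfer → TetraMergingIO` — the OCTAVE
  PIGEONHOLE: thin merging ratio `≥ 1/2` along infinitely many `L` and `thinRatio ℓ L ≤ C Σ_{j≤ℓ} R4ratio(2^jL)` give
  `R4ratio(2^jL) ≥ 1/(4C(ℓ+1))` for some octave `j ≤ ℓ`, along infinitely many scales;
* `tetraMergingIO_of_gap_pt` = the registered sub-goal `Theorems.stub_pinchToTetraReduction :
  EnergyGapPowerLaw → PinchedTransparencyShape cc2 (criticalCorr 3 4) → OctaveTransfer → TetraMergingIO`;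
* `independentStrandsJoin_of_limit_gap_pt_oct : LimitExists → EnergyGapPowerLaw →
  PinchedTransparencyShape cc2 (criticalCorr 3 4) → OctaveTransfer → IndependentStrandsJoin` — the crux BY NAME from
  the four open hypotheses of the line (with the landed `stub_limitUpgrade` and `stub_perScale`): the kernel certificate
  `IndependentStrandsJoin ⟸ {existence of the limit (route crux MoebiusLimit ⊇), ε ≠ σ² (ENS2 crux EnergyGapPowerLaw,
  stmt-CriticalPhenomena-4469), pinched transparency (ENS2's certified residual), octave transfer (new)}` — none of which is
  a lower bound at `β_c(3)` and none of which is implied-by-and-implying the crux.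

Nothing here claims any of the four hypotheses.  References: M. Aizenman, Comm. Math. Phys. 86 (1982) [AizenmanCMP1982];
J. Fröhlich, R. Israel, E. Lieb, B. Simon, Comm. Math. Phys. 62 (1978) (RP Gram minors) [FILS1978]; G. Lawler,
*Intersections of random walks* (1991) ch. 3–5 (the quasi-multiplicativity / separation template behind PT); line card
`Cruxes/IndependentStrandsJoin/Lines/pinch-to-tetra.md`; ENS2 Disproof `Theorems/GapForcesFarMerging/Negative/*`.
-/

noncomputable section

open Filter Topology Finset
open Literature.Probability.LatticeModels
open Summit.CriticalPhenomena.Ising3DConformalLimit.Theses.FKParityRobustness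
open Summit.CriticalPhenomena.Ising3DConformalLimit.Theses.EnergyNotSigmaSquared (EnergyGapPowerLaw)
open Summit.CriticalPhenomena.Ising3DConformalLimit.Theorems.GapForcesFarMerging.Negative
  (e₂ cc2 xR up dn src Th smul_Th smul_Th_pts Th_injective pairCovS TS NparS avoidS SoftPackageNoBubble
   SinglePinchLawShape SinglePinchPositiveShape PinchedTransparencyShape RPUnpinchIsoShape
   singlePinchLaw_of_gap_and_isoRP softPackageNoBubble_criticalCorr)
open Summit.CriticalPhenomena.Ising3DConformalLimit.EnergyNotSigmaSquaredGapForcesFarMerging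
  (rpUnpinchIsoShape_criticalCorr singlePinchPositiveShape_criticalCorr)
open Summit.CriticalPhenomena.Ising3DConformalLimit.EnergyNotSigmaSquaredGapForcesFarMerging.ScaleIteration
  (NparS_pos avoidS_dyadic_le exists_good_scale)
open Summit.CriticalPhenomena.Ising3DConformalLimit.Cruxes.IsingEuclidUpgradeR4NonGaussian.FreeCovarianceDeltaDichotomy
  (criticalCorr_two_pos')

namespace Summit.CriticalPhenomena.Ising3DConformalLimit.Cruxes.IndependentStrandsJoin.PinchToTetra

/-! ## Step B1 — ENS2's scale iteration with the thin shape NAMED in the conclusion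

Verbatim the landed `scaleIteration_soft_transparent` (Negative/TransparentPassage.lean), except that the
contradiction hypothesis is `¬ ThinMergingIO` instead of `¬ FarMergingShape`: the original proof uses the
absence of far merging ONLY at the thin shape `Th(2^ℓ)` with `c = 1/2`, so the same argument proves the
sharper, shape-naming conclusion. -/

section thinIteration

variable {S : Site 3 → Site 3 → ℝ} {T : Site 3 → ℝ} {F : (Fin 4 → Site 3) → ℝ}

/-- **Thin merging from single-pinch law + positivity + pinched transparency** (soft, over the package;
the dyadic iteration of ENS2 with its conclusion sharpened to the named thin shape). [folklore] -/
theorem thinMergingIO_of (hP : SoftPackageNoBubble S T F) :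
    SinglePinchLawShape S T F → SinglePinchPositiveShape S F → PinchedTransparencyShape S F →
      ThinMergingIO S F := by
  rintro ⟨κ', C, hκ', hspl⟩ hSPP hPT
  by_contra hFM
  -- the avoidance sequence along dyadic scales and its positivity
  set A : ℕ → ℝ := fun i => avoidS S F e₂ (2 ^ i) with hA
  have hApos : ∀ i, 0 < A i := fun i =>
    div_pos (hSPP (2 ^ i) Nat.one_le_two_pow) (NparS_pos hP _ _)
  -- r = 2^{-κ'} ∈ (0,1), η = √r; choose ℓ ≥ 1 with η^ℓ ≤ 1/2 and a constant c ≥ η^ℓ along (2^i, 2^{i+ℓ})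
  set r : ℝ := (2 : ℝ) ^ (-κ') with hr
  have hr0 : 0 < r := Real.rpow_pos_of_pos two_pos _
  have hr1 : r < 1 := Real.rpow_lt_one_of_one_lt_of_neg one_lt_two (by linarith)
  set η : ℝ := Real.sqrt r with hη
  have hη0 : 0 < η := Real.sqrt_pos.2 hr0
  have hη1 : η < 1 := by rw [hη, ← Real.sqrt_one]; exact Real.sqrt_lt_sqrt hr0.le hr1
  have hηr : η ^ 2 = r := Real.sq_sqrt hr0.le
  obtain ⟨ℓ₀, hℓ₀⟩ := hPT η hη0 hη1
  obtain ⟨ℓ₁, hℓ₁⟩ := exists_pow_lt_of_lt_one (show (0 : ℝ) < 1 / 2 by norm_num) hη1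
  obtain ⟨ℓ, hℓ1, hℓℓ₀, hℓℓ₁⟩ : ∃ ℓ : ℕ, 1 ≤ ℓ ∧ ℓ₀ ≤ ℓ ∧ ℓ₁ ≤ ℓ :=
    ⟨max (max ℓ₀ ℓ₁) 1, le_max_right _ _, (le_max_left _ _).trans (le_max_left _ _),
      (le_max_right _ _).trans (le_max_left _ _)⟩
  obtain ⟨c, hcη, i₁, hpt⟩ := hℓ₀ ℓ hℓℓ₀
  have hηℓ : 0 < η ^ ℓ := pow_pos hη0 ℓ
  have hc : 0 < c := lt_of_lt_of_le hηℓ hcη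
  have hrℓ : r ^ ℓ ≤ c / 2 := by
    have h1 : η ^ ℓ ≤ 1 / 2 := (pow_le_pow_of_le_one hη0.le hη1.le hℓℓ₁).trans hℓ₁.le
    calc r ^ ℓ = η ^ ℓ * η ^ ℓ := by rw [← hηr, ← pow_mul, mul_comm 2 ℓ, pow_mul, sq]
      _ ≤ (1 / 2) * c := mul_le_mul h1 hcη hηℓ.le (by norm_num)
      _ = c / 2 := by ring
  -- no thin merging along Th(2^ℓ) with c = 1/2 (the ONLY use of the contradiction hypothesis)
  have hFM' := hFM
  unfold ThinMergingIO at hFM'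
  push Not at hFM'
  obtain ⟨L₀, hL₀⟩ := hFM' ℓ hℓ1
  set I₀ : ℕ := max L₀ i₁ with hI₀
  -- one step of the iteration: the conditional call, fed with the non-merging of the branch
  have step : ∀ i, I₀ ≤ i → c * A i ≤ A (i + ℓ) := by
    intro i hi
    have hiL : L₀ ≤ i := (le_max_left _ _).trans hi
    have hi₁ : i₁ ≤ i := (le_max_right _ _).trans hi
    have hL := hL₀ (2 ^ i) (hiL.trans Nat.lt_two_pow_self.le)
    obtain ⟨h0, h1, h2, h3⟩ := smul_Th_pts (2 ^ ℓ) (2 ^ i)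
    rw [smul_Th, h0, h1, h2, h3] at hL
    rw [show 2 ^ ℓ * 2 ^ i = 2 ^ (i + ℓ) by rw [← pow_add, add_comm]] at hL
    exact hpt i hi₁ hL
  -- the iteration
  have iter : ∀ i, I₀ ≤ i → ∀ k : ℕ, c ^ k * A i ≤ A (i + k * ℓ) := by
    intro i hi k
    induction k with
    | zero => simp
    | succ k ih =>
      have hs := step (i + k * ℓ) (by omega)
      rw [show i + (k + 1) * ℓ = i + k * ℓ + ℓ by ring]
      calc c ^ (k + 1) * A i = c * (c ^ k * A i) := by ring
        _ ≤ c * A (i + k * ℓ) := mul_le_mul_of_nonneg_left ih hc.le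
        _ ≤ A (i + k * ℓ + ℓ) := hs
  -- a uniform positive floor over the ℓ starting scales
  obtain ⟨j₀, hj₀, hmin⟩ := Finset.exists_min_image (Finset.range ℓ) (fun j => A (I₀ + j))
    ⟨0, Finset.mem_range.2 (by omega)⟩
  set a₀ := A (I₀ + j₀) with ha₀
  have ha₀pos : 0 < a₀ := hApos _
  have lower : ∀ i, I₀ ≤ i → c ^ ((i - I₀) / ℓ) * a₀ ≤ A i := by
    intro i hi
    have hdecomp : i = I₀ + (i - I₀) % ℓ + (i - I₀) / ℓ * ℓ := by
      have := Nat.mod_add_div (i - I₀) ℓ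
      rw [mul_comm] ; omega
    have hjlt : (i - I₀) % ℓ < ℓ := Nat.mod_lt _ (by omega)
    have h1 := iter (I₀ + (i - I₀) % ℓ) (by omega) ((i - I₀) / ℓ)
    rw [← hdecomp] at h1
    have h2 : a₀ ≤ A (I₀ + (i - I₀) % ℓ) := hmin _ (Finset.mem_range.2 hjlt)
    calc c ^ ((i - I₀) / ℓ) * a₀ ≤ c ^ ((i - I₀) / ℓ) * A (I₀ + (i - I₀) % ℓ) :=
          mul_le_mul_of_nonneg_left h2 (by positivity)
      _ ≤ A i := h1
  -- choose the depth k₀ and a good scale beyond it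
  set Cp : ℝ := max C 0 with hCp
  have hCp0 : 0 ≤ Cp := le_max_right _ _
  obtain ⟨k₀, hk₀⟩ := exists_pow_lt_of_lt_one (show 0 < a₀ / (1024 * Cp + 1) by positivity)
    (show (1 / 2 : ℝ) < 1 by norm_num)
  obtain ⟨i, hiN, hgood⟩ := exists_good_scale hP (I₀ + k₀ * ℓ)
  have hiL : I₀ ≤ i := by omega
  set k : ℕ := (i - I₀) / ℓ with hk
  have hk₀k : k₀ ≤ k := (Nat.le_div_iff_mul_le (by omega)).2 (by omega)
  have hkℓ : k * ℓ ≤ i + 1 := (Nat.div_mul_le_self (i - I₀) ℓ).trans (by omega)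
  -- upper bound at the good scale
  have hup : A i ≤ 1024 * Cp * r ^ (i + 1) := by
    have h := avoidS_dyadic_le hP hspl i
    have hb3 : 0 < S 0 (Pi.single 0 ((2 ^ (i + 3) : ℕ) : ℤ)) := hP.pos _ _
    have hb1 : 0 ≤ S 0 (Pi.single 0 ((2 ^ (i + 1) : ℕ) : ℤ)) := (hP.pos _ _).le
    have hratio : S 0 (Pi.single 0 ((2 ^ (i + 1) : ℕ) : ℤ)) ^ 2 /
        S 0 (Pi.single 0 ((2 ^ (i + 3) : ℕ) : ℤ)) ^ 2 ≤ 1024 := by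
      rw [div_le_iff₀ (by positivity)]
      nlinarith [mul_le_mul hgood hgood hb1 (by positivity)]
    calc A i ≤ Cp * r ^ (i + 1) * S 0 (Pi.single 0 ((2 ^ (i + 1) : ℕ) : ℤ)) ^ 2 /
          S 0 (Pi.single 0 ((2 ^ (i + 3) : ℕ) : ℤ)) ^ 2 := h
      _ = Cp * r ^ (i + 1) * (S 0 (Pi.single 0 ((2 ^ (i + 1) : ℕ) : ℤ)) ^ 2 /
          S 0 (Pi.single 0 ((2 ^ (i + 3) : ℕ) : ℤ)) ^ 2) := by ring
      _ ≤ Cp * r ^ (i + 1) * 1024 := mul_le_mul_of_nonneg_left hratio (by positivity)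
      _ = 1024 * Cp * r ^ (i + 1) := by ring
  -- r^{i+1} ≤ (r^ℓ)^k ≤ (c/2)^k = c^k (1/2)^k
  have hrk : r ^ (i + 1) ≤ c ^ k * (1 / 2) ^ k := by
    calc r ^ (i + 1) ≤ r ^ (k * ℓ) := pow_le_pow_of_le_one hr0.le hr1.le hkℓ
      _ = (r ^ ℓ) ^ k := by rw [mul_comm, pow_mul]
      _ ≤ (c / 2) ^ k := pow_le_pow_left₀ (by positivity) hrℓ k
      _ = c ^ k * (1 / 2) ^ k := by rw [← mul_pow]; ring
  -- combine
  have hck : 0 < c ^ k := by positivity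
  have hmain : c ^ k * a₀ ≤ c ^ k * (1024 * Cp * (1 / 2) ^ k) := by
    calc c ^ k * a₀ ≤ A i := lower i hiL
      _ ≤ 1024 * Cp * r ^ (i + 1) := hup
      _ ≤ 1024 * Cp * (c ^ k * (1 / 2) ^ k) := mul_le_mul_of_nonneg_left hrk (by positivity)
      _ = c ^ k * (1024 * Cp * (1 / 2) ^ k) := by ring
  have h1 : a₀ ≤ 1024 * Cp * (1 / 2) ^ k := le_of_mul_le_mul_left hmain hck
  have h2 : (1 / 2 : ℝ) ^ k ≤ (1 / 2) ^ k₀ := pow_le_pow_of_le_one (by norm_num) (by norm_num) hk₀k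
  have h3 : (1 / 2 : ℝ) ^ k₀ * (1024 * Cp + 1) < a₀ := by
    rwa [lt_div_iff₀ (by positivity)] at hk₀
  nlinarith [mul_le_mul_of_nonneg_left h2 (by positivity : (0 : ℝ) ≤ 1024 * Cp),
    pow_pos (show (0 : ℝ) < 1 / 2 by norm_num) k₀]

end thinIteration

/-- **Thin merging for the critical correlators from GAP and pinched transparency** (all other inputs
landed: isosceles RP minors, strict single-pinch positivity, the soft package). [folklore] -/
theorem thinMergingIO_criticalCorr (hgap : EnergyGapPowerLaw)
    (hpt : PinchedTransparencyShape cc2 (criticalCorr 3 4)) : ThinMergingIO cc2 (criticalCorr 3 4) :=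
  thinMergingIO_of softPackageNoBubble_criticalCorr
    (singlePinchLaw_of_gap_and_isoRP rpUnpinchIsoShape_criticalCorr hgap)
    singlePinchPositiveShape_criticalCorr hpt

/-! ## Step B2 — octave pigeonhole: thin merging i.o. + octave transfer ⇒ tetrahedral merging i.o. -/

/-- The Aizenman normalisation of the thin configuration is positive. [folklore] -/
theorem Nthin_pos (ℓ L : ℕ) : 0 < Nthin ℓ L :=
  mul_pos (criticalCorr_two_pos' _ _) (criticalCorr_two_pos' _ _)

/-- `GGcrit > 0`. [folklore] -/
theorem GGcrit_pos (t : ℕ) : 0 < GGcrit t :=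
  mul_pos (criticalCorr_two_pos' _ _) (criticalCorr_two_pos' _ _)

/-- **Octave pigeonhole.**  Thin merging along infinitely many scales (ratio `≥ 1/2` at the named thin
shape) and the octave-transfer inequality give tetrahedral merging along infinitely many scales, with
constant `1/(4C(ℓ+1))`. [folklore] -/
theorem tetraMergingIO_of_thin (hthin : ThinMergingIO cc2 (criticalCorr 3 4)) (hoct : OctaveTransfer) :
    TetraMergingIO := by
  obtain ⟨ℓ, hℓ1, hio⟩ := hthin
  obtain ⟨C, hC, hbound⟩ := hoct ℓ
  set θ : ℝ := 1 / (4 * C * (ℓ + 1)) with hθ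
  have hθpos : 0 < θ := by positivity
  refine ⟨θ, hθpos, fun L₀ => ?_⟩
  obtain ⟨L, hL₀L, hL⟩ := hio (max L₀ 1)
  have hL1 : 1 ≤ L := (le_max_right _ _).trans hL₀L
  have hLL₀ : L₀ ≤ L := (le_max_left _ _).trans hL₀L
  -- read the thin inequality in the `dn/src/up` vocabulary
  obtain ⟨h0, h1, h2, h3⟩ := smul_Th_pts (2 ^ ℓ) L
  rw [smul_Th, h0, h1, h2, h3] at hL
  have hU : U4thin ℓ L ≤ -(1 / 2 * Nthin ℓ L) := hL
  have hN := Nthin_pos ℓ L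
  have hratio : 1 / 2 ≤ thinRatio ℓ L := by
    unfold thinRatio
    rw [le_div_iff₀ hN]
    linarith
  -- the octave sum is at least `1/(2C)`
  have hsum : 1 / (2 * C) ≤ ∑ j ∈ Finset.range (ℓ + 1), R4ratio (2 ^ j * L) := by
    have h := hbound L hL1
    have : 1 / 2 ≤ C * ∑ j ∈ Finset.range (ℓ + 1), R4ratio (2 ^ j * L) := hratio.trans h
    rw [div_le_iff₀ (by positivity)]
    nlinarith
  -- pigeonhole over the `ℓ+1` octaves
  obtain ⟨j, hj, hge⟩ : ∃ j ∈ Finset.range (ℓ + 1), θ ≤ R4ratio (2 ^ j * L) := by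
    by_contra hall
    push Not at hall
    have hle : ∑ j ∈ Finset.range (ℓ + 1), R4ratio (2 ^ j * L) ≤ ∑ _j ∈ Finset.range (ℓ + 1), θ :=
      Finset.sum_le_sum fun j hj => (hall j hj).le
    rw [Finset.sum_const, Finset.card_range, nsmul_eq_mul] at hle
    have hval : ((ℓ + 1 : ℕ) : ℝ) * θ = 1 / (4 * C) := by
      rw [hθ]; push_cast; field_simp
    rw [hval] at hle
    have : 1 / (2 * C) ≤ 1 / (4 * C) := hsum.trans hle
    rw [div_le_div_iff_of_pos_left one_pos (by positivity) (by positivity)] at this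
    linarith
  -- the tetrahedral scale `t = 2^j L ≥ L ≥ L₀`
  refine ⟨2 ^ j * L, hLL₀.trans (Nat.le_mul_of_pos_left L (Nat.two_pow_pos j)), ?_⟩
  have hGG := GGcrit_pos (2 ^ j * L)
  have h := hge
  unfold R4ratio at h
  rw [le_div_iff₀ hGG] at h
  linarith

/-- **`TetraMergingIO` from GAP, pinched transparency and octave transfer.** [folklore] -/
theorem tetraMergingIO_of_gap_pt (hgap : EnergyGapPowerLaw) (hpt : PinchedTransparencyShape cc2 (criticalCorr 3 4))
    (hoct : OctaveTransfer) : TetraMergingIO :=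
  tetraMergingIO_of_thin (thinMergingIO_criticalCorr hgap hpt) hoct

/-! ## The five-piece composition: the crux BY NAME from the four open hypotheses of the line -/

/-- **`IndependentStrandsJoin` from `LimitExists`, GAP, pinched transparency and octave transfer** (the landed
`Theorems.stub_limitUpgrade` fed with `tetraMergingIO_of_gap_pt` and the landed per-scale crux
`Theorems.stub_perScale`). [folklore] -/
theorem independentStrandsJoin_of_limit_gap_pt_oct (hL : LimitExists) (hgap : EnergyGapPowerLaw)
    (hpt : PinchedTransparencyShape cc2 (criticalCorr 3 4)) (hoct : OctaveTransfer) :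
    Summit.CriticalPhenomena.Ising3DConformalLimit.Theses.FKParityRobustness.IndependentStrandsJoin :=
  Summit.CriticalPhenomena.Ising3DConformalLimit.Theorems.stub_limitUpgrade hL (tetraMergingIO_of_gap_pt hgap hpt hoct)
    Summit.CriticalPhenomena.Ising3DConformalLimit.Theorems.stub_perScale

end Summit.CriticalPhenomena.Ising3DConformalLimit.Cruxes.IndependentStrandsJoin.PinchToTetra

/-! ## The registered sub-goal `stub_pinchToTetraReduction` -/

namespace Summit.CriticalPhenomena.Ising3DConformalLimit.Theorems

open Summit.CriticalPhenomena.Ising3DConformalLimit.Cruxes.IndependentStrandsJoin.PinchToTetra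

/-- **Registered sub-goal `stub_pinchToTetraReduction` of the crux `IndependentStrandsJoin`** (stmt-CriticalPhenomena-14625,
line `pinch-to-tetra`): `ε ≠ σ²` (GAP), pinched transparency and octave transfer force tetrahedral far merging along
infinitely many scales (`PinchToTetra.tetraMergingIO_of_gap_pt`). -/
theorem stub_pinchToTetraReduction :
    EnergyGapPowerLaw → PinchedTransparencyShape cc2 (criticalCorr 3 4) → OctaveTransfer → TetraMergingIO :=
  tetraMergingIO_of_gap_pt

end Summit.CriticalPhenomena.Ising3DConformalLimit.Theorems

end
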